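import Mathlib
import Summits.NavierStokesRegularity.NavierStokesRegularity.Theorems.TaoLadderRungTwoBreakBlowupRigidityOneFrontBundle
import HarnessLib

/-!
# The action ceiling (F2a) of the front bundle SPLITS at the firing time: the post-firing part is FREE from the amplitude
  ceiling and the upper clock, so the front bundle of `stub_eternalFromBlowup` (K2(1) `TaoLadderRungTwoBreak.BlowupRigidityOne`,
  stmt-NavierStokesRegularity-20206) needs only the PRE-FIRING action bound `Λ^k ∫₀^{τ_k} ‖x_k‖ ≤ A'` («L¹ quietness before arrival»)

MODEL lattice ODEs only (Tao 2016 §4 (4.8), §6.4); nothing here is a statement about the Navier–Stokes equations; NO item is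
closed (`--supports stmt-NavierStokesRegularity-20206`). Route-independent; general `m` (`m = 4` in the stub-shaped corollary);
DEF-FREE.

* `action_le_prefiring_add` — with the amplitude ceiling `‖x_k(t)‖ ≤ B ν^k` on `[0,T)` and a time `τ_k ∈ [0,T)` on the
  self-similar schedule `(Λ²ν²)^k (T-τ_k)² ≤ κ₂`: `Λ^k ∫_{[0,T)} ‖x_k‖ ≤ Λ^k ∫₀^{τ_k} ‖x_k‖ + B√κ₂`;
* `stub_eternalFromBlowup_of_prefiringFronts` — the REGISTERED STUB SIGNATURE of `stub_eternalFromBlowup` verbatim from the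
  front bundle with (i) replaced by: no shells below `0` + a PRE-FIRING action bound `Λ^k ∫₀^{τ_k} ‖x_k‖ ≤ A'` at the floor
  times `τ_k` of (iii). With `energyClimbing_of_noGlobalCascade` (p820545: `‖x_{k+1}(t)‖ ≤ C_AΛ^k∫₀ᵗ‖x_k‖²`, unconditional)
  this is the honest remaining shape of (F2a): the front must arrive at shell `k` within an `O((Λν)^{-k})` window of `τ_k`
  in `L¹` — a passage-time statement.

HONEST LABEL: bookkeeping; the pre-firing bound, the amplitude ceiling at a surviving ratio and the clocked floors are OPEN;
no stub, crux or summit is proved; rung 0.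
-/

noncomputable section

-- the summit and its single sub-problem share the name (CONVENTIONS §1)
set_option linter.dupNamespace false

open Set Filter Topology MeasureTheory intervalIntegral

namespace Summit.NavierStokesRegularity.NavierStokesRegularity.Theorems

namespace BlowupRigidityOne

open Literature.Analysis.FluidPDE Literature.Analysis.FluidPDE.TaoCascade

variable {m : ℕ}

/-- **Post-firing action is free.** [cite: Tao2016AveragedNS, §4 (4.8), §6.4; cell vocabulary (the `action` clause of `IsEternal`)] -/
theorem action_le_prefiring_add {ε₀ T B ν κ₂ : ℝ} (hε : 0 < ε₀) {X : Fin m → ℤ → ℝ → ℝ}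
    (hcont : ∀ k : ℤ, ContinuousOn (fun t => shellVec X k t) (Ico 0 T))
    (hamp : ∀ (j : ℤ) (t : ℝ), 0 ≤ t → t < T → ‖shellVec X j t‖ ≤ B * ν ^ j)
    (k : ℕ) {τ : ℝ} (hτ0 : 0 ≤ τ) (hτT : τ < T) (hclock : (bigLam ε₀ ^ 2 * ν ^ 2) ^ k * (T - τ) ^ 2 ≤ κ₂) :
    IntegrableOn (fun t => ‖shellVec X (k : ℤ) t‖) (Ico 0 T) ∧
      bigLam ε₀ ^ (k : ℤ) * (∫ t in Ico 0 T, ‖shellVec X (k : ℤ) t‖) ≤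
        bigLam ε₀ ^ (k : ℤ) * (∫ t in (0 : ℝ)..τ, ‖shellVec X (k : ℤ) t‖) + B * Real.sqrt κ₂ := by
  have hΛ : 0 < bigLam ε₀ := bigLam_pos (by linarith)
  have hB : 0 ≤ B := by
    have h := hamp 0 0 le_rfl (lt_of_le_of_lt hτ0 hτT)
    rw [zpow_zero, mul_one] at h
    exact (norm_nonneg _).trans h
  have hT : 0 < T := lt_of_le_of_lt hτ0 hτT
  -- integrability on `[0,T)`: bounded and continuous on a finite interval
  have hmeas : AEStronglyMeasurable (fun t => ‖shellVec X (k : ℤ) t‖) (volume.restrict (Ico 0 T)) :=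
    ((hcont k).norm).aestronglyMeasurable measurableSet_Ico
  have hbdd : ∀ t ∈ Ico (0 : ℝ) T, ‖shellVec X (k : ℤ) t‖ ≤ B * ν ^ (k : ℤ) := fun t ht => hamp k t ht.1 ht.2
  have hint : IntegrableOn (fun t => ‖shellVec X (k : ℤ) t‖) (Ico 0 T) :=
    ⟨hmeas, HasFiniteIntegral.restrict_of_bounded (B * ν ^ (k : ℤ)) measure_Ico_lt_top
      ((ae_restrict_mem measurableSet_Ico).mono fun t ht => by rw [norm_norm]; exact hbdd t ht)⟩
  refine ⟨hint, ?_⟩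
  -- split `[0,T) = [0,τ) ∪ [τ,T)`
  have hsplit : ∫ t in Ico 0 T, ‖shellVec X (k : ℤ) t‖ =
      (∫ t in Ico 0 τ, ‖shellVec X (k : ℤ) t‖) + ∫ t in Ico τ T, ‖shellVec X (k : ℤ) t‖ := by
    rw [← Ico_union_Ico_eq_Ico hτ0 hτT.le,
      setIntegral_union (Ico_disjoint_Ico_same) measurableSet_Ico
        (hint.mono_set (Ico_subset_Ico_right hτT.le)) (hint.mono_set (Ico_subset_Ico_left hτ0))]
  have h1 : ∫ t in Ico 0 τ, ‖shellVec X (k : ℤ) t‖ = ∫ t in (0 : ℝ)..τ, ‖shellVec X (k : ℤ) t‖ := by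
    rw [intervalIntegral.integral_of_le hτ0, setIntegral_congr_set Ico_ae_eq_Ioc]
  have h2 : ∫ t in Ico τ T, ‖shellVec X (k : ℤ) t‖ ≤ B * ν ^ (k : ℤ) * (T - τ) := by
    have h := setIntegral_mono_on (hint.mono_set (Ico_subset_Ico_left hτ0))
      (integrableOn_const (measure_Ico_lt_top.ne)) measurableSet_Ico
      (fun t ht => hbdd t ⟨hτ0.trans ht.1, ht.2⟩) (g := fun _ => B * ν ^ (k : ℤ))
    rw [setIntegral_const, smul_eq_mul, measureReal_def, Real.volume_Ico,
      ENNReal.toReal_ofReal (by linarith)] at h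
    linarith
  have hρ : bigLam ε₀ ^ (k : ℤ) * (B * ν ^ (k : ℤ) * (T - τ)) ≤ B * Real.sqrt κ₂ := by
    have hq : (bigLam ε₀ ^ 2 * ν ^ 2) ^ k = ((bigLam ε₀ * ν) ^ k) ^ 2 := by rw [← mul_pow, ← pow_mul, ← pow_mul, Nat.mul_comm]
    have hu : (bigLam ε₀ * ν) ^ k * (T - τ) ≤ Real.sqrt κ₂ := by
      have h : ((bigLam ε₀ * ν) ^ k * (T - τ)) ^ 2 ≤ κ₂ := by rw [mul_pow, ← hq]; exact hclock
      exact (le_abs_self _).trans (Real.abs_le_sqrt h)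
    calc bigLam ε₀ ^ (k : ℤ) * (B * ν ^ (k : ℤ) * (T - τ)) = B * ((bigLam ε₀ * ν) ^ k * (T - τ)) := by
          rw [zpow_natCast, zpow_natCast, mul_pow]; ring
      _ ≤ B * Real.sqrt κ₂ := mul_le_mul_of_nonneg_left hu hB
  rw [hsplit, h1, mul_add]
  have h3 := mul_le_mul_of_nonneg_left h2 (zpow_pos hΛ (k : ℤ)).le
  linarith

/-- **THE REGISTERED STUB `stub_eternalFromBlowup` (skeleton `9d85f4d387c689cd`) MODULO THE FRONT BUNDLE WITH ONLY A
PRE-FIRING ACTION BOUND.** [cite: Tao2016AveragedNS, §4 Thm. 4.2, §6.4; KochNadirashviliSereginSverak2009, Thm 1.1 ff.; cell vocabulary (`NoGlobalCascade`, `IsEternal`, `EternalSurvivingFwd`)] -/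
theorem stub_eternalFromBlowup_of_prefiringFronts
    (H : ∀ R : ℝ, 1 ≤ R → ∃ εs : ℝ, 0 < εs ∧ ∀ ε₀ : ℝ, 0 < ε₀ → ε₀ ≤ εs →
      ∀ (α : (Fin 4 → Fin 4 → Fin 4 → ℤ × ℤ × ℤ → ℝ)) (X₀ : Fin 4 → ℝ),
        InTableClass R α → NoGlobalCascade ε₀ α X₀ →
        ∃ (T A' B ν cf κ₂ : ℝ) (X : Fin 4 → ℤ → ℝ → ℝ) (τ : ℕ → ℝ), 0 < T ∧
          (∀ i n, ContDiffOn ℝ 1 (X i n) (Set.Ico 0 T)) ∧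
          (∀ i n t, 0 ≤ t → t < T → derivWithin (X i n) (Set.Ici 0) t = quadTerm ε₀ α X i n t) ∧
          (∀ i n t, n < 0 → X i n t = 0) ∧
          0 < ν ∧ (1 + ε₀)⁻¹ ≤ ν ^ 2 ∧
          (∀ (j : ℤ) (t : ℝ), 0 ≤ t → t < T → ‖shellVec X j t‖ ≤ B * ν ^ j) ∧
          0 < cf ∧ 0 < κ₂ ∧
          (∀ k : ℕ, 0 ≤ τ k ∧ τ k < T ∧ cf * (ν ^ 2) ^ k ≤ ‖shellVec X (k : ℤ) (τ k)‖ ^ 2 ∧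
            (bigLam ε₀ ^ 2 * ν ^ 2) ^ k * (T - τ k) ^ 2 ≤ κ₂) ∧
          (∀ k : ℕ, bigLam ε₀ ^ (k : ℤ) * (∫ t in (0 : ℝ)..τ k, ‖shellVec X (k : ℤ) t‖) ≤ A')) :
    ∀ R : ℝ, 1 ≤ R → ∃ εs : ℝ, 0 < εs ∧ ∀ ε₀ : ℝ, 0 < ε₀ → ε₀ ≤ εs →
      ∀ (α : (Fin 4 → Fin 4 → Fin 4 → ℤ × ℤ × ℤ → ℝ)) (X₀ : Fin 4 → ℝ),
        Literature.Analysis.FluidPDE.TaoCascade.InTableClass R α →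
        Literature.Analysis.FluidPDE.TaoCascade.NoGlobalCascade ε₀ α X₀ →
        ∃ W : ℤ → ℝ → Literature.Analysis.FluidPDE.TaoCascade.Em 4,
          Literature.Analysis.FluidPDE.TaoCascade.IsEternal ε₀ α W ∧
          Literature.Analysis.FluidPDE.TaoCascade.EternalSurvivingFwd 1 ε₀ W := by
  refine stub_eternalFromBlowup_of_fronts fun R hR => ?_
  obtain ⟨εs, hεs, hH⟩ := H R hR
  refine ⟨εs, hεs, fun ε₀ hε hεle α X₀ hα hNG => ?_⟩
  obtain ⟨T, A', B, ν, cf, κ₂, X, τ, hT, hC1, hmot, hlow, hν, hν1, hamp, hcf, hκ₂, hfire, hpre⟩ :=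
    hH ε₀ hε hεle α X₀ hα hNG
  have hΛ : 0 < bigLam ε₀ := bigLam_pos (by linarith)
  have hcont : ∀ k : ℤ, ContinuousOn (fun t => shellVec X k t) (Ico 0 T) := fun k =>
    continuousOn_shellVec_of_contDiffOn hC1 k
  -- negative shells vanish
  have hneg : ∀ k : ℤ, k < 0 → ∀ t, shellVec X k t = 0 := fun k hk t => by
    ext i; simp [shellVec, hlow i k t hk]
  refine ⟨T, max (A' + B * Real.sqrt κ₂) 0, B, ν, cf, κ₂, X, hT, hC1, hmot, fun k => ?_, hν, hν1, hamp, hcf, hκ₂,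
    fun k => ?_⟩
  · rcases lt_or_ge k 0 with hk | hk
    · refine ⟨?_, ?_⟩
      · refine (integrableOn_zero).congr_fun (fun t _ => ?_) measurableSet_Ico
        simp only [hneg k hk t, norm_zero]
      · have : ∫ t in Ico 0 T, ‖shellVec X k t‖ = 0 := by
          rw [setIntegral_congr_fun measurableSet_Ico (fun t _ => by rw [hneg k hk t, norm_zero])]
          simp
        rw [this, mul_zero]
        exact le_max_right _ _
    · obtain ⟨n, rfl⟩ := Int.eq_ofNat_of_zero_le hk
      obtain ⟨hτ0, hτT, -, hclock⟩ := hfire n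
      obtain ⟨hint, hle⟩ := action_le_prefiring_add hε hcont hamp n hτ0 hτT hclock
      exact ⟨hint, (hle.trans (by linarith [hpre n])).trans (le_max_left _ _)⟩
  · obtain ⟨hτ0, hτT, hfl, hclock⟩ := hfire k
    exact ⟨τ k, hτ0, hτT, hfl, hclock⟩

end BlowupRigidityOne

end Summit.NavierStokesRegularity.NavierStokesRegularity.Theorems

end
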